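import Literature.AlgebraicGeometry.Resolution.DerivativeIdealSheaf
import Mathlib.RingTheory.Kaehler.Polynomial
import Mathlib.RingTheory.Finiteness.Cardinality
import HarnessLib

/-!
# `HasFinitePresentationDifferentials` is a hypothesis, not a theorem

Topic: `Literature/AlgebraicGeometry/Resolution`. The predicate
`HasFinitePresentationDifferentials φ` of `DerivativeIdealSheaf.lean` ("the Kähler differentials
`Ω[Γ(X,U)⁄k]` of every affine piece of the `k`-scheme `X` are finitely presented") is a
**parametrised hypothesis** on the `k`-structure `φ : k →+* Γ(X, 𝒪_X)` (its binder is supplied by a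
`variable`, so the declaration reads `def HasFinitePresentationDifferentials : Prop` although its type
is `(φ : k →+* Γ(X, ⊤)) → Prop`).  Downstream it is always consumed as an explicit hypothesis
`(hX : HasFinitePresentationDifferentials φ)`, and the published situations in which it holds are
already proved there: `hasFinitePresentationDifferentials_of_finitePresentation` (affine pieces of
finite presentation over `k`) and `hasFinitePresentationDifferentials_overHom` (`X → Spec k` locally
of finite presentation, e.g. a variety — the setting of Bierstone–Grigoriev–Milman–Włodarczyk,
arXiv:1206.3090, §3.5).

This file records, with proof, that the hypothesis is **not automatic**, so that no unconditional
`theorem HasFinitePresentationDifferentials_holds` can exist: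

* `finite_kaehlerDifferential_of_surjective` — finiteness of `Ω[–⁄k]` descends along a surjective
  `k`-algebra map (functoriality `KaehlerDifferential.map_surjective_of_surjective`);
* `not_finite_kaehlerDifferential_mvPolynomial` — for a nontrivial ring `k` and an infinite set of
  variables `ι`, `Ω[k[ι]⁄k]` is **not** a finitely generated `k[ι]`-module (it is free on the
  `dxᵢ`, `KaehlerDifferential.mvPolynomialBasis`; Hartshorne, *Algebraic Geometry*, II Ex. 8.2.1 /
  Matsumura, *Commutative Ring Theory*, §25, for finitely many variables — the computation is the same);
* `not_hasFinitePresentationDifferentials_spec_mvPolynomial` — hence the affine `k`-scheme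
  `X = Spec k[xᵢ : i ∈ ℕ]` with its tautological `k`-structure does **not** satisfy
  `HasFinitePresentationDifferentials`;
* `not_forall_hasFinitePresentationDifferentials` — over every nontrivial base ring `k` the universal
  closure `∀ X φ, HasFinitePresentationDifferentials φ` is false.

## Sources

* [folklore] `Ω_{A[xᵢ]/A}` is free on the `dxᵢ` (Hartshorne II Ex. 8.2.1; Matsumura CRT §25);
  Mathlib `KaehlerDifferential.mvPolynomialBasis`.
-/

namespace Literature.AlgebraicGeometry.Resolution

open CategoryTheory _root_.AlgebraicGeometry TopologicalSpace Opposite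

universe u v w

section Transport

/-- **Finiteness of Kähler differentials descends along surjections**: if `f : A → B` is a
surjective `k`-algebra map and `Ω[A⁄k]` is a finitely generated `A`-module, then `Ω[B⁄k]` is a
finitely generated `B`-module (`Ω[A⁄k] → Ω[B⁄k]` is onto, `KaehlerDifferential.map_surjective_of_surjective`).
[folklore] -/
theorem finite_kaehlerDifferential_of_surjective {k : Type u} {A : Type v} {B : Type w} [CommRing k]
    [CommRing A] [CommRing B] [Algebra k A] [Algebra k B] (f : A →ₐ[k] B)
    (hf : Function.Surjective f) [Module.Finite A Ω[A⁄k]] : Module.Finite B Ω[B⁄k] := by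
  letI : Algebra A B := f.toRingHom.toAlgebra
  haveI : IsScalarTower k A B := IsScalarTower.of_algebraMap_eq fun x => (f.commutes x).symm
  haveI : Module.Finite A Ω[B⁄k] :=
    Module.Finite.of_surjective (KaehlerDifferential.map k k A B)
      (KaehlerDifferential.map_surjective_of_surjective k k A B hf)
  exact Module.Finite.of_restrictScalars_finite A B Ω[B⁄k]

/-- **`Ω[k[ι]⁄k]` is not finitely generated for infinitely many variables** (`k` nontrivial): it is
the free `k[ι]`-module on the `dxᵢ`, `i ∈ ι`. [folklore] -/
theorem not_finite_kaehlerDifferential_mvPolynomial (k : Type u) [CommRing k] [Nontrivial k]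
    (ι : Type v) [Infinite ι] :
    ¬ Module.Finite (MvPolynomial ι k) Ω[MvPolynomial ι k⁄k] :=
  Module.not_finite_of_infinite_basis (KaehlerDifferential.mvPolynomialBasis k ι)

end Transport

section Spec

/-- **The finiteness hypothesis fails for `Spec k[xᵢ : i ∈ ℕ]`** (`k` nontrivial) with its
tautological `k`-structure `k → k[ℕ] ≅ Γ(Spec k[ℕ], 𝒪)`: already the affine piece `U = X` has
`Ω[Γ(X, 𝒪_X)⁄k] ≅ Ω[k[ℕ]⁄k]`, free of infinite rank. Hence `HasFinitePresentationDifferentials`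
is a genuine hypothesis (no unconditional `_holds` theorem exists). [folklore] -/
theorem not_hasFinitePresentationDifferentials_spec_mvPolynomial (k : Type u) [CommRing k]
    [Nontrivial k] :
    ¬ HasFinitePresentationDifferentials
      ((Scheme.ΓSpecIso (.of (MvPolynomial ℕ k))).inv.hom.comp
        (algebraMap k (MvPolynomial ℕ k))) := by
  intro h
  -- notation
  let R : Type u := MvPolynomial ℕ k
  let X : Scheme.{u} := Spec (.of R)
  let φ : k →+* Γ(X, ⊤) := (Scheme.ΓSpecIso (.of R)).inv.hom.comp (algebraMap k R)
  -- the affine piece `U = X`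
  have hU : IsAffineOpen (⊤ : X.Opens) := isAffineOpen_top X
  letI : Algebra k Γ(X, ⊤) := sectionsAlgebra φ ⊤
  haveI : Module.FinitePresentation Γ(X, ⊤) Ω[Γ(X, ⊤)⁄k] := h ⟨⊤, hU⟩
  -- the `k`-algebra isomorphism `Γ(X, 𝒪_X) → k[ℕ]`
  let e : Γ(X, ⊤) →ₐ[k] R :=
    { (Scheme.ΓSpecIso (.of R)).hom.hom with
      commutes' := fun c => by
        change (Scheme.ΓSpecIso (.of R)).hom.hom (sectionsHom φ ⊤ c) = algebraMap k R c
        rw [sectionsHom_top]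
        exact CommRingCat.hom_inv_apply (Scheme.ΓSpecIso (.of R)) (algebraMap k R c) }
  have he : Function.Surjective e := fun r =>
    ⟨(Scheme.ΓSpecIso (.of R)).inv.hom r, CommRingCat.hom_inv_apply (Scheme.ΓSpecIso (.of R)) r⟩
  haveI : Module.Finite R Ω[R⁄k] := finite_kaehlerDifferential_of_surjective e he
  exact not_finite_kaehlerDifferential_mvPolynomial k ℕ this

/-- **The universal closure of `HasFinitePresentationDifferentials` is false** over every
nontrivial base ring `k`: not every `k`-scheme has finitely presented differentials on its affine
pieces (witness `Spec k[xᵢ : i ∈ ℕ]`). The predicate is therefore consumed as a hypothesis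
`(hX : HasFinitePresentationDifferentials φ)`; it holds for `X` locally of finite presentation over
`k` (`hasFinitePresentationDifferentials_overHom`). [folklore] -/
theorem not_forall_hasFinitePresentationDifferentials (k : Type u) [CommRing k] [Nontrivial k] :
    ¬ ∀ (X : Scheme.{u}) (φ : k →+* Γ(X, ⊤)), HasFinitePresentationDifferentials φ :=
  fun h => not_hasFinitePresentationDifferentials_spec_mvPolynomial k (h _ _)

end Spec

end Literature.AlgebraicGeometry.Resolution
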